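import Literature.Geometry.Lorentzian.KerrSchildDivergence
import Mathlib.Analysis.SpecialFunctions.ExpDeriv
import HarnessLib

/-!
# The wave operator of the Kerr metric in Kerr–Schild form: `□_g = □_η − 2H ∂²_{ℓ♯ℓ♯} − (2M/Σ) ∂_{ℓ♯}`,
# complex-valued fields, and time-harmonic fields

(family `gr`; infrastructure for separated solutions of `□_g ψ = μ² ψ` on Kerr, namespace
`Literature.Geometry.Lorentzian.Kerr`)

`KerrSchildCoord.lean` and `KerrSchildDivergence.lean` prove, for the prelude's wave operator
`PseudoRiemannianMetric.dalembertian` of the Kerr metric `g = η + 2H ℓ ⊗ ℓ` in ingoing Kerr–Schild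
coordinates, the chart formula `□_g ψ = ∑ g^{μν}(∂_μ∂_ν Φ − Γ(∂_ν,∂_μ)Φ)`, the contraction
`∑ g^{μν} Γ(∂_ν, ∂_μ) = −∑ c^ν ∂_ν` and `c^ν = ∑_μ ∂_μ g^{μν} = −(2M/Σ) (ℓ♯)^ν`. This file packages
them into the compact form familiar from the Kerr–Schild literature (Kerr–Schild 1965, §2: the
inverse metric is `g^{μν} = η^{μν} − 2H ℓ^μ ℓ^ν`; `ℓ♯` is geodesic with expansion `2r/Σ`):

* `dalembertian_eq_ksBox`: for `ψ = Φ|_U` with `Φ : E4 → ℝ` of class `C²` at `x ∈ Kerr.region a r₀`,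
  `□_g ψ (x) = ∑_μ η^{μμ} ∂_μ∂_μ Φ(x) − 2H(x) D²Φ(x)(ℓ♯, ℓ♯) − (2M/Σ(x)) DΦ(x)(ℓ♯)` (`ksBox`);
* `dalembertian_re_eq`, `dalembertian_im_eq`: for a complex field `Ψ : E4 → ℂ` of class `C²` the
  same formula computes `□_g (Re Ψ)` and `□_g (Im Ψ)` as real and imaginary parts of the complex
  Kerr–Schild operator `ksBoxC` (the wave operator is real, `Re`/`Im` commute with real derivatives);
* `ksBoxC_timeHarmonic`: for a **time-harmonic** field `Ψ(x) = e^{−iω x⁰} Φ(x)` with `Φ` independent of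
  `x⁰ = t_KS` (`∂_{t_KS}` is Killing and `(ℓ♯)⁰ = −1`),
  `ksBoxC Ψ = e^{−iωx⁰} [ω²(1 + 2H)Φ − (2iMω/Σ)Φ − (4iωH + 2M/Σ) ∂_{ℓ♯}Φ + ΔΦ − 2H ∂²_{ℓ♯ℓ♯}Φ]`,
  `Δ` the flat spatial Laplacian — the reduction of `□_g − μ²` on modes `e^{−iωt}Φ` to a stationary
  operator (Shlapentokh-Rothman, CMP 329 (2014), §1.3 and §2, where it is further separated in
  Boyer–Lindquist `(r, θ, φ)`).

## References

* R. P. Kerr, A. Schild, 1965, §2 (key `KerrSchild1965`).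
* Y. Shlapentokh-Rothman, Comm. Math. Phys. 329 (2014), §1.3 (mode solutions), §2
  (key `ShlapentokhRothman2014KleinGordon`).
-/

noncomputable section

open Set Filter
open scoped Topology Manifold ContDiff

namespace Literature.Geometry.Lorentzian.Kerr

/-! ### The compact Kerr–Schild form of `□_g` on real functions -/

/-- The **Kerr–Schild form of the wave operator** on a real function `Φ : E4 → ℝ` at `x`:
`ksBox M a Φ x = ∑_μ η^{μμ} ∂_μ∂_μΦ(x) − 2H(x) D²Φ(x)(ℓ♯ₓ, ℓ♯ₓ) − (2M/Σ(x)) DΦ(x)(ℓ♯ₓ)` with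
`η = diag(−1,1,1,1)`, `H = Mr³/(r⁴ + a²z²)`, `Σ = r² + a²z²/r²`, `ℓ♯ = (−1, ℓ⃗)` (Kerr–Schild 1965,
§2: `g^{μν} = η^{μν} − 2Hℓ^μℓ^ν`, `det g = −1`). It computes `□_g` (`dalembertian_eq_ksBox`).
[cite: KerrSchild1965, §2] -/
def ksBox (M a : ℝ) (Φ : E4 → ℝ) (x : E4) : ℝ :=
  (∑ μ, etaComp μ μ * fderiv ℝ (fderiv ℝ Φ) x (E4.basisVector μ) (E4.basisVector μ)) -
    2 * scalarH M a x * fderiv ℝ (fderiv ℝ Φ) x (nullVector a x) (nullVector a x) -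
    2 * M / blSigma a (E4.spatial x) * fderiv ℝ Φ x (nullVector a x)

/-- Contraction of a bilinear map with `ℓ♯ ⊗ ℓ♯` in the coordinate basis:
`∑_{μν} (ℓ♯)^ν (ℓ♯)^μ B(∂_μ, ∂_ν) = B(ℓ♯, ℓ♯)`. [folklore] -/
theorem sum_sum_nullVector_mul_apply_basisVector (B : E4 →L[ℝ] E4 →L[ℝ] ℝ) (a : ℝ) (x : E4) :
    ∑ μ, ∑ ν, nullVector a x ν * nullVector a x μ * B (E4.basisVector μ) (E4.basisVector ν) =
      B (nullVector a x) (nullVector a x) := by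
  have key : ∀ u : E4, B u (nullVector a x) = ∑ ν, nullVector a x ν * B u (E4.basisVector ν) := by
    intro u
    conv_lhs => rw [eq_sum_basisVector (nullVector a x)]
    rw [map_sum]
    exact Finset.sum_congr rfl fun ν _ ↦ by rw [map_smul, smul_eq_mul]
  have key2 : B (nullVector a x) = ∑ μ, nullVector a x μ • B (E4.basisVector μ) := by
    conv_lhs => rw [eq_sum_basisVector (nullVector a x)]
    rw [map_sum]
    exact Finset.sum_congr rfl fun μ _ ↦ by rw [map_smul]
  rw [key2, sum_apply]
  refine Finset.sum_congr rfl fun μ _ ↦ ?_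
  rw [smul_apply, key, smul_eq_mul, Finset.mul_sum]
  exact Finset.sum_congr rfl fun ν _ ↦ by ring

/-- **`□_g = □_η − 2H ∂²_{ℓ♯ℓ♯} − (2M/Σ) ∂_{ℓ♯}` on the Kerr–Schild chart.** For `ψ : Kerr.region a r₀ → ℝ`
with a representative `Φ : E4 → ℝ` (`ψ y = Φ y`) of class `C²` at `x`,
`□_g ψ (x) = ksBox M a Φ x` (chart formula `dalembertian_eq_sum`, `∑ g^{μν}Γ(∂_ν,∂_μ) = −∑ c^ν ∂_ν`,
`c^ν = −(2M/Σ)(ℓ♯)^ν`, `g^{μν} = η^{μν} − 2H ℓ^μℓ^ν`). Here `□_g` is the prelude's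
`PseudoRiemannianMetric.dalembertian` of `Kerr.smoothMetric M a r₀` under `[Kerr.Facts] [Kerr.SliceFacts]`.
Kerr–Schild 1965, §2. [cite: KerrSchild1965, §2] -/
theorem dalembertian_eq_ksBox [Facts] [SliceFacts] (M a r₀ : ℝ) {ψ : region a r₀ → ℝ}
    {Φ : E4 → ℝ} (hψ : ∀ y, ψ y = Φ y) (x : region a r₀) (hΦ : ContDiffAt ℝ 2 Φ x) :
    (smoothMetric M a r₀).toPseudoRiemannianMetric.dalembertian ψ x = ksBox M a Φ x := by
  have hx := radius_pos_of_mem_region x.2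
  rw [dalembertian_eq_sum M a r₀ hψ x hΦ]
  -- split the double sum
  simp only [mul_sub, Finset.sum_sub_distrib]
  -- the first-order part: `∑ g^{μν} DΦ(Γ(e_ν,e_μ)) = DΦ(∑ g^{μν} Γ(e_ν,e_μ)) = −∑ c^ν ∂_νΦ`
  have hfirst : ∑ μ, ∑ ν, inverseMetric M a x μ ν * fderiv ℝ Φ x
      (OpensChart.christoffel (smoothMetric M a r₀).toPseudoRiemannianMetric (bilin M a) x
        (E4.basisVector ν) (E4.basisVector μ)) =
      2 * M / blSigma a (E4.spatial (x : E4)) * fderiv ℝ Φ x (nullVector a x) := by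
    have h := congrArg (fderiv ℝ Φ x) (sum_christoffel_eq M a r₀ x)
    simp only [map_sum, map_smul, smul_eq_mul, map_neg] at h
    rw [h]
    simp only [divInverseMetric_eq M a hx, neg_mul, Finset.sum_neg_distrib, neg_neg, mul_assoc,
      ← Finset.mul_sum]
    congr 1
    rw [← sum_apply_basisVector_mul_nullVector (fderiv ℝ Φ x) a x]
    exact Finset.sum_congr rfl fun ν _ ↦ mul_comm _ _
  -- the second-order part
  have hsecond : ∑ μ, ∑ ν, inverseMetric M a x μ ν *
      fderiv ℝ (fderiv ℝ Φ) x (E4.basisVector μ) (E4.basisVector ν) =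
      (∑ μ, etaComp μ μ * fderiv ℝ (fderiv ℝ Φ) x (E4.basisVector μ) (E4.basisVector μ)) -
        2 * scalarH M a x * fderiv ℝ (fderiv ℝ Φ) x (nullVector a x) (nullVector a x) := by
    have hg : ∀ μ ν, inverseMetric M a x μ ν =
        etaComp μ ν - 2 * scalarH M a x * nullVector a x ν * nullVector a x μ := by
      intro μ ν; rw [inverseMetric_apply]; rfl
    rw [Finset.sum_congr rfl fun μ _ ↦ Finset.sum_congr rfl fun ν _ ↦ by rw [hg μ ν, sub_mul]]
    simp only [Finset.sum_sub_distrib]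
    congr 1
    · refine Finset.sum_congr rfl fun μ _ ↦ ?_
      have : ∀ ν, etaComp μ ν * fderiv ℝ (fderiv ℝ Φ) x (E4.basisVector μ) (E4.basisVector ν) =
          if μ = ν then etaComp μ μ * fderiv ℝ (fderiv ℝ Φ) x (E4.basisVector μ)
            (E4.basisVector μ) else 0 := by
        intro ν
        by_cases h : μ = ν
        · subst h; simp
        · simp [etaComp, h]
      rw [Finset.sum_congr rfl fun ν _ ↦ this ν, Finset.sum_ite_eq]
      simp
    · rw [← sum_sum_nullVector_mul_apply_basisVector (fderiv ℝ (fderiv ℝ Φ) x) a x,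
        Finset.mul_sum]
      refine Finset.sum_congr rfl fun μ _ ↦ ?_
      rw [Finset.mul_sum]
      exact Finset.sum_congr rfl fun ν _ ↦ by ring
  rw [hsecond, hfirst, ksBox]

/-! ### Complex-valued fields: `Re` and `Im` commute with the (real) wave operator -/

/-- The **complex Kerr–Schild operator**: the same formula on a complex field `Ψ : E4 → ℂ`
(real Fréchet derivatives of a `ℂ`-valued map), so that `□_g(Re Ψ) = Re(ksBoxC Ψ)`,
`□_g(Im Ψ) = Im(ksBoxC Ψ)`. Kerr–Schild 1965, §2. [cite: KerrSchild1965, §2] -/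
def ksBoxC (M a : ℝ) (Ψ : E4 → ℂ) (x : E4) : ℂ :=
  (∑ μ, (etaComp μ μ : ℂ) * fderiv ℝ (fderiv ℝ Ψ) x (E4.basisVector μ) (E4.basisVector μ)) -
    2 * (scalarH M a x : ℂ) * fderiv ℝ (fderiv ℝ Ψ) x (nullVector a x) (nullVector a x) -
    2 * (M : ℂ) / (blSigma a (E4.spatial x) : ℂ) * fderiv ℝ Ψ x (nullVector a x)

/-- For `Ψ : E4 → ℂ` differentiable at `x` and a real-linear `L : ℂ →L[ℝ] ℝ` (e.g. `Re`, `Im`),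
`D(L ∘ Ψ)(x) v = L(DΨ(x) v)`. [folklore] -/
theorem fderiv_clm_comp_apply (L : ℂ →L[ℝ] ℝ) {Ψ : E4 → ℂ} {x : E4} (hΨ : DifferentiableAt ℝ Ψ x)
    (v : E4) : fderiv ℝ (fun y ↦ L (Ψ y)) x v = L (fderiv ℝ Ψ x v) := by
  rw [show (fun y ↦ L (Ψ y)) = L ∘ Ψ from rfl, fderiv_comp x L.differentiableAt hΨ, L.fderiv]
  rfl

/-- **Second derivatives commute with real-linear maps**: for `Ψ : E4 → ℂ` of class `C²` at `x` and
`L : ℂ →L[ℝ] ℝ`, `D²(L ∘ Ψ)(x)(v, w) = L(D²Ψ(x)(v, w))`. [folklore] -/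
theorem fderiv_fderiv_clm_comp_apply (L : ℂ →L[ℝ] ℝ) {Ψ : E4 → ℂ} {x : E4}
    (hΨ : ContDiffAt ℝ 2 Ψ x) (v w : E4) :
    fderiv ℝ (fderiv ℝ (fun y ↦ L (Ψ y))) x v w = L (fderiv ℝ (fderiv ℝ Ψ) x v w) := by
  -- `Ψ` is differentiable near `x` and `DΨ` is differentiable at `x`
  have h1 : ∀ᶠ y in 𝓝 x, DifferentiableAt ℝ Ψ y :=
    (hΨ.eventually (by norm_num)).mono fun y hy ↦ hy.differentiableAt (by norm_num)
  have h2 : DifferentiableAt ℝ (fderiv ℝ Ψ) x :=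
    (hΨ.fderiv_right (m := 1) le_rfl).differentiableAt one_ne_zero
  have hL2 : ContDiffAt ℝ 2 (fun y ↦ L (Ψ y)) x := L.contDiff.contDiffAt.comp x hΨ
  have h2L : DifferentiableAt ℝ (fderiv ℝ fun y ↦ L (Ψ y)) x :=
    (hL2.fderiv_right (m := 1) le_rfl).differentiableAt one_ne_zero
  -- `D²F(x)(v,w) = ∂_v (y ↦ DF(y) w)(x)` for both functions
  have hclm : ∀ {F : E4 → ℝ}, DifferentiableAt ℝ (fderiv ℝ F) x →
      fderiv ℝ (fderiv ℝ F) x v w = fderiv ℝ (fun y ↦ fderiv ℝ F y w) x v := by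
    intro F hF
    have := hF.hasFDerivAt.clm_apply (hasFDerivAt_const w x)
    rw [this.fderiv]
    simp
  have hclmC : fderiv ℝ (fderiv ℝ Ψ) x v w = fderiv ℝ (fun y ↦ fderiv ℝ Ψ y w) x v := by
    have := h2.hasFDerivAt.clm_apply (hasFDerivAt_const w x)
    rw [this.fderiv]
    simp
  rw [hclm h2L, hclmC]
  -- near `x`, `D(L∘Ψ)(y) w = L (DΨ(y) w)`
  have hev : (fun y ↦ fderiv ℝ (fun y ↦ L (Ψ y)) y w) =ᶠ[𝓝 x] fun y ↦ L (fderiv ℝ Ψ y w) := by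
    filter_upwards [h1] with y hy using fderiv_clm_comp_apply L hy w
  rw [hev.fderiv_eq]
  have hd : DifferentiableAt ℝ (fun y ↦ fderiv ℝ Ψ y w) x := h2.clm_apply (differentiableAt_const w)
  exact fderiv_clm_comp_apply L (Ψ := fun y ↦ fderiv ℝ Ψ y w) hd v

/-- `ksBox` of `L ∘ Ψ` is `L` of `ksBoxC Ψ` for every real-linear `L : ℂ →L[ℝ] ℝ` and `Ψ` of class
`C²` at `x` (the coefficients are real). [folklore] -/
theorem ksBox_clm_comp (L : ℂ →L[ℝ] ℝ) (M a : ℝ) {Ψ : E4 → ℂ} {x : E4} (hΨ : ContDiffAt ℝ 2 Ψ x) :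
    ksBox M a (fun y ↦ L (Ψ y)) x = L (ksBoxC M a Ψ x) := by
  have hd : DifferentiableAt ℝ Ψ x := hΨ.differentiableAt (by norm_num)
  simp only [ksBox, ksBoxC, fderiv_fderiv_clm_comp_apply L hΨ, fderiv_clm_comp_apply L hd,
    map_sub, map_sum]
  congr 1
  · congr 1
    · refine Finset.sum_congr rfl fun μ _ ↦ ?_
      rw [show (etaComp μ μ : ℂ) * fderiv ℝ (fderiv ℝ Ψ) x (E4.basisVector μ) (E4.basisVector μ) =
        (etaComp μ μ : ℝ) • fderiv ℝ (fderiv ℝ Ψ) x (E4.basisVector μ) (E4.basisVector μ) by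
        rw [Complex.real_smul], map_smul, smul_eq_mul]
    · rw [show (2 : ℂ) * (scalarH M a x : ℂ) *
          fderiv ℝ (fderiv ℝ Ψ) x (nullVector a x) (nullVector a x) =
        (2 * scalarH M a x : ℝ) • fderiv ℝ (fderiv ℝ Ψ) x (nullVector a x) (nullVector a x) by
        rw [Complex.real_smul]; push_cast; ring, map_smul, smul_eq_mul]
  · rw [show (2 : ℂ) * (M : ℂ) / (blSigma a (E4.spatial x) : ℂ) * fderiv ℝ Ψ x (nullVector a x) =
      (2 * M / blSigma a (E4.spatial x) : ℝ) • fderiv ℝ Ψ x (nullVector a x) by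
      rw [Complex.real_smul]; push_cast; ring, map_smul, smul_eq_mul]

/-- **`□_g (Re Ψ) = Re (ksBoxC Ψ)`** for a complex field `Ψ` of class `C²` at `x ∈ Kerr.region a r₀`
(restricted to the chart). Real and imaginary parts of complex solutions of the real equation
`(□_g − μ²)Ψ = 0` are real solutions (Shlapentokh-Rothman, CMP 329 (2014), §1.3).
[cite: ShlapentokhRothman2014KleinGordon, §1.3] -/
theorem dalembertian_re_eq [Facts] [SliceFacts] (M a r₀ : ℝ) {Ψ : E4 → ℂ} (x : region a r₀)
    (hΨ : ContDiffAt ℝ 2 Ψ x) :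
    (smoothMetric M a r₀).toPseudoRiemannianMetric.dalembertian
        (fun y : region a r₀ ↦ (Ψ y).re) x = (ksBoxC M a Ψ x).re := by
  have h := dalembertian_eq_ksBox M a r₀ (ψ := fun y : region a r₀ ↦ (Ψ y).re)
    (Φ := fun y ↦ Complex.reCLM (Ψ y)) (fun _ ↦ rfl) x
    (Complex.reCLM.contDiff.contDiffAt.comp (x : E4) hΨ)
  rw [h, ksBox_clm_comp Complex.reCLM M a hΨ]
  rfl

/-- **`□_g (Im Ψ) = Im (ksBoxC Ψ)`** for a complex field `Ψ` of class `C²` at `x ∈ Kerr.region a r₀`.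
[cite: ShlapentokhRothman2014KleinGordon, §1.3] -/
theorem dalembertian_im_eq [Facts] [SliceFacts] (M a r₀ : ℝ) {Ψ : E4 → ℂ} (x : region a r₀)
    (hΨ : ContDiffAt ℝ 2 Ψ x) :
    (smoothMetric M a r₀).toPseudoRiemannianMetric.dalembertian
        (fun y : region a r₀ ↦ (Ψ y).im) x = (ksBoxC M a Ψ x).im := by
  have h := dalembertian_eq_ksBox M a r₀ (ψ := fun y : region a r₀ ↦ (Ψ y).im)
    (Φ := fun y ↦ Complex.imCLM (Ψ y)) (fun _ ↦ rfl) x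
    (Complex.imCLM.contDiff.contDiffAt.comp (x : E4) hΨ)
  rw [h, ksBox_clm_comp Complex.imCLM M a hΨ]
  rfl

/-! ### Time-harmonic fields `e^{−iω t_KS} Φ` with `Φ` stationary -/

/-- The time coordinate `x⁰` as a real-linear map into `ℂ`. [folklore] -/
def timeCLM : E4 →L[ℝ] ℂ := Complex.ofRealCLM.comp (EuclideanSpace.proj (0 : Fin 4))

/-- `timeCLM x = x⁰`. [folklore] -/
@[simp]
theorem timeCLM_apply (x : E4) : timeCLM x = ((x 0 : ℝ) : ℂ) := rfl

/-- The **time-harmonic phase** `e^{−iω x⁰}`. [cite: ShlapentokhRothman2014KleinGordon, §1.3 (1.5)] -/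
def phase (w : ℂ) (x : E4) : ℂ := Complex.exp (-(Complex.I * w) * ((x 0 : ℝ) : ℂ))

/-- `D(e^{−iωx⁰}) = e^{−iωx⁰} · (−iω dx⁰)`. [folklore] -/
theorem hasFDerivAt_phase (w : ℂ) (x : E4) :
    HasFDerivAt (phase w) (phase w x • ((-(Complex.I * w)) • timeCLM)) x := by
  have hL : HasFDerivAt (fun y : E4 ↦ -(Complex.I * w) * ((y 0 : ℝ) : ℂ))
      ((-(Complex.I * w)) • timeCLM) x := by
    have := (timeCLM.hasFDerivAt (x := x)).const_mul (-(Complex.I * w))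
    simpa using this
  have h := (Complex.hasDerivAt_exp (-(Complex.I * w) * ((x 0 : ℝ) : ℂ))).comp_hasFDerivAt x hL
  exact h

/-- The phase is smooth. [folklore] -/
theorem contDiff_phase (w : ℂ) {n : WithTop ℕ∞} : ContDiff ℝ n (phase w) := by
  have : phase w = fun x ↦ Complex.exp ((-(Complex.I * w)) • timeCLM x) := by
    funext x; simp [phase, smul_eq_mul]
  rw [this]
  exact Complex.contDiff_exp.comp (((-(Complex.I * w)) • timeCLM).contDiff)

/-- A field `Φ : E4 → ℂ` is **stationary** (independent of `t_KS = x⁰`) if it is invariant under the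
flow of `∂_{t_KS}`: `Φ(x + s ∂₀) = Φ(x)`. [folklore] -/
def IsStationaryField (Φ : E4 → ℂ) : Prop := ∀ (x : E4) (s : ℝ), Φ (x + s • E4.basisVector 0) = Φ x

namespace IsStationaryField

variable {Φ : E4 → ℂ}

/-- A stationary field has `∂₀Φ = 0` (at points of non-differentiability both sides are the junk
value `0`). [folklore] -/
theorem fderiv_basisVector_zero (hΦ : IsStationaryField Φ) (x : E4) :
    fderiv ℝ Φ x (E4.basisVector 0) = 0 := by
  by_cases hd : DifferentiableAt ℝ Φ x
  · have h1 : HasLineDerivAt ℝ Φ (fderiv ℝ Φ x (E4.basisVector 0)) x (E4.basisVector 0) :=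
      hd.hasFDerivAt.hasLineDerivAt _
    have h2 : HasLineDerivAt ℝ Φ 0 x (E4.basisVector 0) := by
      have : (fun s : ℝ ↦ Φ (x + s • E4.basisVector 0)) = fun _ ↦ Φ x := funext fun s ↦ hΦ x s
      show HasDerivAt (fun s : ℝ ↦ Φ (x + s • E4.basisVector 0)) 0 0
      rw [this]
      exact hasDerivAt_const 0 _
    exact h1.unique h2
  · rw [fderiv_zero_of_not_differentiableAt hd]
    rfl

/-- A stationary field differentiable everywhere has `∂₀(∂_w Φ) = 0`: the partial `y ↦ DΦ(y) w` is
again stationary. [folklore] -/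
theorem fderiv_apply_isStationary (hΦ : IsStationaryField Φ) (w : E4) :
    IsStationaryField fun y ↦ fderiv ℝ Φ y w := by
  intro x s
  have hfun : (fun y ↦ Φ (y + s • E4.basisVector 0)) = Φ := funext fun y ↦ hΦ y s
  have h := fderiv_comp_add_right (𝕜 := ℝ) (f := Φ) (x := x) (s • E4.basisVector 0)
  rw [hfun] at h
  show fderiv ℝ Φ (x + s • E4.basisVector 0) w = fderiv ℝ Φ x w
  rw [h]

end IsStationaryField

/-- `(ℓ♯)⁰ = −1`: `dx⁰(ℓ♯) = −1`. [cite: KerrSchild1965, §2] -/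
theorem timeCLM_nullVector (a : ℝ) (x : E4) : timeCLM (nullVector a x) = -1 := by
  rw [timeCLM_apply, nullVector_apply]
  simp

/-- `dx⁰(∂_μ) = δ_{μ0}`. [folklore] -/
theorem timeCLM_basisVector (μ : Fin 4) : timeCLM (E4.basisVector μ) = if μ = 0 then 1 else 0 := by
  rw [timeCLM_apply]
  by_cases h : μ = 0
  · subst h; simp [E4.basisVector]
  · simp [E4.basisVector, h, Ne.symm h]

section TimeHarmonic

variable {w : ℂ} {Φ : E4 → ℂ}

/-- **First derivative of a time-harmonic field**: for `Ψ = e^{−iωx⁰}Φ` with `Φ` differentiable at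
`y`, `DΨ(y) v = e^{−iωy⁰}(−iω v⁰ Φ(y) + DΦ(y) v)`. [folklore] -/
theorem hasFDerivAt_timeHarmonic {y : E4} (hΦ : DifferentiableAt ℝ Φ y) :
    HasFDerivAt (fun x ↦ phase w x * Φ x)
      (phase w y • ((-(Complex.I * w) * Φ y) • timeCLM + fderiv ℝ Φ y)) y := by
  have h := (hasFDerivAt_phase w y).mul hΦ.hasFDerivAt
  refine h.congr_fderiv ?_
  ext v
  simp only [add_apply, smul_apply, smul_eq_mul, timeCLM_apply]
  ring

/-- The first derivative of a time-harmonic field as a function near a point where `Φ` is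
differentiable: `DΨ(y) v = e^{−iωy⁰}(−iω v⁰ Φ(y) + DΦ(y) v)`. [folklore] -/
theorem fderiv_timeHarmonic_apply {y : E4} (hΦ : DifferentiableAt ℝ Φ y) (v : E4) :
    fderiv ℝ (fun x ↦ phase w x * Φ x) y v =
      phase w y * (-(Complex.I * w) * timeCLM v * Φ y + fderiv ℝ Φ y v) := by
  rw [(hasFDerivAt_timeHarmonic hΦ).fderiv]
  simp only [smul_apply, add_apply, smul_eq_mul]
  ring

/-- **Second derivative of a time-harmonic field** in a pair of directions `(v, v)`:
`D²Ψ(x)(v,v) = e^{−iωx⁰}((−iωv⁰)² Φ + 2(−iωv⁰) DΦ(v) + D²Φ(v,v))` for `Φ` of class `C²` at `x`.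
[folklore] -/
theorem fderiv_fderiv_timeHarmonic (x : E4) (hΦ : ContDiffAt ℝ 2 Φ x) (v : E4) :
    fderiv ℝ (fderiv ℝ (fun y ↦ phase w y * Φ y)) x v v =
      phase w x * ((-(Complex.I * w) * timeCLM v) ^ 2 * Φ x +
        2 * (-(Complex.I * w) * timeCLM v) * fderiv ℝ Φ x v + fderiv ℝ (fderiv ℝ Φ) x v v) := by
  have h1 : ∀ᶠ y in 𝓝 x, DifferentiableAt ℝ Φ y :=
    (hΦ.eventually (by norm_num)).mono fun y hy ↦ hy.differentiableAt (by norm_num)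
  have hd : DifferentiableAt ℝ Φ x := hΦ.differentiableAt (by norm_num)
  have h2 : DifferentiableAt ℝ (fderiv ℝ Φ) x :=
    (hΦ.fderiv_right (m := 1) le_rfl).differentiableAt one_ne_zero
  have hΨ2 : ContDiffAt ℝ 2 (fun y ↦ phase w y * Φ y) x := (contDiff_phase w).contDiffAt.mul hΦ
  have hΨd2 : DifferentiableAt ℝ (fderiv ℝ fun y ↦ phase w y * Φ y) x :=
    (hΨ2.fderiv_right (m := 1) le_rfl).differentiableAt one_ne_zero
  -- `D²Ψ(v,v) = ∂_v (y ↦ DΨ(y) v)`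
  have hclm : fderiv ℝ (fderiv ℝ (fun y ↦ phase w y * Φ y)) x v v =
      fderiv ℝ (fun y ↦ fderiv ℝ (fun y ↦ phase w y * Φ y) y v) x v := by
    have := hΨd2.hasFDerivAt.clm_apply (hasFDerivAt_const v x)
    rw [this.fderiv]; simp
  have hclmΦ : fderiv ℝ (fderiv ℝ Φ) x v v = fderiv ℝ (fun y ↦ fderiv ℝ Φ y v) x v := by
    have := h2.hasFDerivAt.clm_apply (hasFDerivAt_const v x)
    rw [this.fderiv]; simp
  rw [hclm]
  -- near `x`, `DΨ(y) v` is the explicit product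
  have hev : (fun y ↦ fderiv ℝ (fun y ↦ phase w y * Φ y) y v) =ᶠ[𝓝 x]
      fun y ↦ phase w y * (-(Complex.I * w) * timeCLM v * Φ y + fderiv ℝ Φ y v) := by
    filter_upwards [h1] with y hy using fderiv_timeHarmonic_apply hy v
  rw [hev.fderiv_eq]
  -- differentiate the product
  have hA : HasFDerivAt (fun y ↦ -(Complex.I * w) * timeCLM v * Φ y + fderiv ℝ Φ y v)
      ((-(Complex.I * w) * timeCLM v) • fderiv ℝ Φ x + (fderiv ℝ (fderiv ℝ Φ) x).flip v) x := by
    have ha := hd.hasFDerivAt.const_mul (-(Complex.I * w) * timeCLM v)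
    have hb : HasFDerivAt (fun y ↦ fderiv ℝ Φ y v) ((fderiv ℝ (fderiv ℝ Φ) x).flip v) x := by
      have := h2.hasFDerivAt.clm_apply (hasFDerivAt_const v x)
      simpa using this
    exact ha.add hb
  have hP : HasFDerivAt (fun y ↦ phase w y * (-(Complex.I * w) * timeCLM v * Φ y + fderiv ℝ Φ y v))
      (phase w x • ((-(Complex.I * w) * timeCLM v) • fderiv ℝ Φ x + (fderiv ℝ (fderiv ℝ Φ) x).flip v) +
        (-(Complex.I * w) * timeCLM v * Φ x + fderiv ℝ Φ x v) •
          (phase w x • ((-(Complex.I * w)) • timeCLM))) x :=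
    (hasFDerivAt_phase w x).mul hA
  rw [hP.fderiv]
  simp only [add_apply, smul_apply, smul_eq_mul, ContinuousLinearMap.flip_apply, hclmΦ]
  ring

/-- **The Kerr–Schild operator on a time-harmonic field with stationary amplitude.** For
`Ψ = e^{−iωx⁰} Φ` with `Φ` stationary and of class `C²` at `x` (a point with `r > 0` is not needed for
the identity itself),
`ksBoxC Ψ (x) = e^{−iωx⁰} [ω²(1 + 2H)Φ − (2iMω/Σ)Φ − (4iωH + 2M/Σ) DΦ(ℓ♯) + ΔΦ − 2H D²Φ(ℓ♯,ℓ♯)]`,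
`ΔΦ = ∑_{j=1}^3 ∂_j∂_jΦ` (using `(ℓ♯)⁰ = −1`, `∂₀Φ = 0`, `∂₀∂₀Φ = 0`). This is the stationary
reduction of `□_g` on modes (SR, CMP 329 (2014), §1.3, §2). [cite: ShlapentokhRothman2014KleinGordon, §1.3] -/
theorem ksBoxC_timeHarmonic (M a : ℝ) (hst : IsStationaryField Φ) (x : E4)
    (hΦ : ContDiffAt ℝ 2 Φ x) :
    ksBoxC M a (fun y ↦ phase w y * Φ y) x =
      phase w x * (w ^ 2 * (1 + 2 * scalarH M a x) * Φ x
        - 2 * Complex.I * M * w / blSigma a (E4.spatial x) * Φ x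
        - (4 * Complex.I * w * scalarH M a x + 2 * M / blSigma a (E4.spatial x)) *
            fderiv ℝ Φ x (nullVector a x)
        + (∑ j : Fin 3, fderiv ℝ (fderiv ℝ Φ) x (E4.basisVector j.succ) (E4.basisVector j.succ))
        - 2 * scalarH M a x * fderiv ℝ (fderiv ℝ Φ) x (nullVector a x) (nullVector a x)) := by
  have hd : DifferentiableAt ℝ Φ x := hΦ.differentiableAt (by norm_num)
  have h2 : DifferentiableAt ℝ (fderiv ℝ Φ) x :=
    (hΦ.fderiv_right (m := 1) le_rfl).differentiableAt one_ne_zero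
  -- stationarity: `∂₀Φ = 0` everywhere, hence `∂₀∂₀Φ(x) = 0`
  have h0 : ∀ y, fderiv ℝ Φ y (E4.basisVector 0) = 0 := fun y ↦ hst.fderiv_basisVector_zero y
  have h00 : fderiv ℝ (fderiv ℝ Φ) x (E4.basisVector 0) (E4.basisVector 0) = 0 := by
    have hclm : fderiv ℝ (fderiv ℝ Φ) x (E4.basisVector 0) (E4.basisVector 0) =
        fderiv ℝ (fun y ↦ fderiv ℝ Φ y (E4.basisVector 0)) x (E4.basisVector 0) := by
      have := h2.hasFDerivAt.clm_apply (hasFDerivAt_const (E4.basisVector 0) x)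
      rw [this.fderiv]; simp
    rw [hclm, show (fun y ↦ fderiv ℝ Φ y (E4.basisVector 0)) = fun _ ↦ (0 : ℂ) from funext h0]
    simp
  -- the pieces
  have hμ : ∀ μ : Fin 4, fderiv ℝ (fderiv ℝ (fun y ↦ phase w y * Φ y)) x (E4.basisVector μ)
      (E4.basisVector μ) = phase w x * ((-(Complex.I * w) * (if μ = 0 then 1 else 0)) ^ 2 * Φ x +
        2 * (-(Complex.I * w) * (if μ = 0 then 1 else 0)) * fderiv ℝ Φ x (E4.basisVector μ) +
        fderiv ℝ (fderiv ℝ Φ) x (E4.basisVector μ) (E4.basisVector μ)) := by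
    intro μ
    rw [fderiv_fderiv_timeHarmonic x hΦ, timeCLM_basisVector]
  have hn : fderiv ℝ (fderiv ℝ (fun y ↦ phase w y * Φ y)) x (nullVector a x) (nullVector a x) =
      phase w x * ((-(Complex.I * w) * (-1)) ^ 2 * Φ x +
        2 * (-(Complex.I * w) * (-1)) * fderiv ℝ Φ x (nullVector a x) +
        fderiv ℝ (fderiv ℝ Φ) x (nullVector a x) (nullVector a x)) := by
    rw [fderiv_fderiv_timeHarmonic x hΦ, timeCLM_nullVector]
  have h1 : fderiv ℝ (fun y ↦ phase w y * Φ y) x (nullVector a x) =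
      phase w x * (-(Complex.I * w) * (-1) * Φ x + fderiv ℝ Φ x (nullVector a x)) := by
    rw [fderiv_timeHarmonic_apply hd, timeCLM_nullVector]
  rw [ksBoxC, Fin.sum_univ_four, hμ 0, hμ 1, hμ 2, hμ 3, hn, h1, Fin.sum_univ_three]
  simp only [Fin.isValue, ↓reduceIte, one_ne_zero, Fin.reduceEq, h0, h00, etaComp]
  simp only [show (Fin.succ (0 : Fin 3)) = 1 from rfl, show (Fin.succ (1 : Fin 3)) = 2 from rfl,
    show (Fin.succ (2 : Fin 3)) = 3 from rfl]
  push_cast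
  linear_combination (-(phase w x) * w ^ 2 * Φ x * (1 + 2 * scalarH M a x)) * Complex.I_sq

end TimeHarmonic

end Literature.Geometry.Lorentzian.Kerr
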